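import Summits.RiemannHypothesis.RiemannHypothesis.Theses.WeilSemilocal
import Summits.RiemannHypothesis.RiemannHypothesis.Theorems.HandoffDodgerRateSevenCeiling
import HarnessLib

/-!
# Route WeilSemilocal — the item `DodgerFamilyFromTenThousand` (stmt-RiemannHypothesis-19394) HOLDS, by the RH-free rate-7/100 dodger chain

Cell `rh-explicit`, WEIL column, seat dodger-p2 gen2 (director-rh g7 words 6/9: by-product theorem; the item itself was closed «moot» when
route-RiemannHypothesis-WeilSemilocal closed·proved at 2026-08-26T23:00Z — this leaf records that its statement is nevertheless a THEOREM).
`DodgerFamilyFromTenThousand` is literally `Handoff.SubwindowZeroSumFamily (7/100) 10000`: for every pair of consecutive primes `q < q′` with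
`q ≥ 10⁴`, a Weil test function in the `q`-subwindow, a shift `0 ≤ δ ≤ (7/100)(log q)^{3/2}q^{−3/2}` inside the window, and a bound of every
truncated zero sum of the translate pair strictly below the weighted collar — proved by `Handoff.subwindowZeroSumFamily_tenThousand`
(`Theorems/HandoffDodgerRateSevenCeiling.lean`, parts `HandoffDodgerRateSeven{Horizon,Profile,Window,Cost,Phi}`).
RH-FREE upper-side bookkeeping only; nothing here bears on the truth of RH.
-/

set_option linter.dupNamespace false

noncomputable section

namespace Summit.RiemannHypothesis.RiemannHypothesis.Theorems.WeilSemilocalRoute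

open Summit.RiemannHypothesis.RiemannHypothesis.Theorems.Handoff

/-- **`DodgerFamilyFromTenThousand` (stmt-RiemannHypothesis-19394) holds**: the RH-free zero-sum family at rate `(7/100)(log q)^{3/2}q^{−3/2}`
from `q₀ = 10⁴`. [this cell, DODGER-STAGE2-PLAN; RH-FREE] -/
theorem dodgerFamilyFromTenThousand_proof :
    Summit.RiemannHypothesis.RiemannHypothesis.Theses.WeilSemilocal.DodgerFamilyFromTenThousand := by
  unfold Theses.WeilSemilocal.DodgerFamilyFromTenThousand
  exact subwindowZeroSumFamily_tenThousand

end Summit.RiemannHypothesis.RiemannHypothesis.Theorems.WeilSemilocalRoute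

end
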